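import Mathlib
import Summits.Ventures.PercRepro2.CoinChainXATopGateInterp

/-!
# The `mj` gate of the (j, j′) pair — the 46-term certificate
(blind cell PercRepro2, night-2 g30; §72.13)

The PRINCIPAL-FILTER gate `d' = d·1[{m, j} ⊆ W]` (the `mj` corner of the three-coin corner programme,
§71.9): on the parts model its (XA′) functional times `t` is a sum of 46 products (coefficients 1, 2, 3)
of the facts `JU`, `JM_x`, `McM`, the two-marker fact `(YJ + YU)·XM ≤ (a + δ + u)·XYM`, the
surviving-vs-sure-entered facts `BB` and `YU·XM ≤ (a + u)·XYM`, the sure-entered `XM·YM ≤ t·XYM` and the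
box (Handelman LP kit j324133, degree 5, products of ≤ 2 facts; exact in rationals,
mining/night-2/g30/py/gen_mj.py).  The gate's moments: `e = (a + δ + u + XM, XJ + XU + XM, YJ + YU + XYM)`,
`g = (a + XM, XM, XYM, XYM)` — the gate-open mass on the sure-entered clusters is their `x`-mass, its
`y`-marked part the top mass `XYM`.
-/

namespace Summit.Ventures.PercRepro2.Coin

section MjGateAlg

variable {R : Type*} [Field R] [LinearOrder R] [IsStrictOrderedRing R]

/-- **The `mj`-gate functional times `t` is a sum of 46 products of the facts.** -/
theorem cg_mj_full_mul (a δ u t XJ XU XM YJ YU YM XYM : R)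
    (ha : 0 ≤ a) (hδ : 0 ≤ δ) (hu : 0 ≤ u) (ht : 0 ≤ t) (hXJ : 0 ≤ XJ) (hXU : 0 ≤ XU) (hXM : 0 ≤ XM)
    (hYJ : 0 ≤ YJ) (hYU : 0 ≤ YU) (hYM : 0 ≤ YM) (hXYM : 0 ≤ XYM)
    (hJUx : 0 ≤ XU * (a + δ) - XJ * u) (hJMx : 0 ≤ XM * (a + δ) - XJ * t)
    (hMcMx : 0 ≤ XM * (a + δ + u) - (XJ + XU) * t) (hJUy : 0 ≤ YU * (a + δ) - YJ * u)
    (hMcMy : 0 ≤ YM * (a + δ + u) - (YJ + YU) * t) (hMcM2 : 0 ≤ XYM * (a + δ + u) - (YJ + YU) * XM)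
    (hBx : 0 ≤ XM * (a + u) - XU * t) (hBy : 0 ≤ YM * (a + u) - YU * t)
    (hBB2 : 0 ≤ XYM * (a + u) - YU * XM) (hMM : 0 ≤ XYM * t - XM * YM)
    (hXUu : 0 ≤ u - XU) (hXMt : 0 ≤ t - XM) :
    0 ≤ t * ((a + δ + u + t) * ((a + δ + u + t) * (a + δ + u + t) * XYM - (a + δ + u + t) * (YJ + YU + YM) * XM - (a + δ + u + t) * (XJ + XU + XM) * XYM + (XJ + XU + XM) * (YJ + YU + YM) * (a + XM)) - (((a + δ + u + t) * (XU + XM) - (XJ + XU + XM) * (a + u + t)) * ((a + δ + u + t) * (YJ + YU + XYM) - (YJ + YU + YM) * (a + δ + u + XM)) + ((a + δ + u + t) * (YU + YM) - (YJ + YU + YM) * (a + u + t)) * ((a + δ + u + t) * (XJ + XU + XM) - (XJ + XU + XM) * (a + δ + u + XM)))) := by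
  have hT1 : 0 ≤ (a + δ) * (δ + u) - δ * δ := by nlinarith [mul_nonneg ha hδ, mul_nonneg ha hu, mul_nonneg hδ hu]
  have hT2 : 0 ≤ (a + δ) * (YJ + YU) - δ * YJ := by nlinarith [mul_nonneg ha hYJ, mul_nonneg ha hYU, mul_nonneg hδ hYU]
  have hT3 : 0 ≤ a * (δ + u) := mul_nonneg ha (add_nonneg hδ hu)
  have hT4 : 0 ≤ a * (XJ + XU) := mul_nonneg ha (add_nonneg hXJ hXU)
  have hT5 : 0 ≤ a * (YJ + YU) := mul_nonneg ha (add_nonneg hYJ hYU)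
  have H0 := (mul_nonneg (mul_nonneg (mul_nonneg (mul_nonneg ha ht) ht) ht) hXYM)
  have H1 := (mul_nonneg (mul_nonneg (mul_nonneg hT3 hXJ) hYJ) ht)
  have H2 := (mul_nonneg (mul_nonneg (mul_nonneg hT3 hYJ) hXU) ht)
  have H3 := (mul_nonneg (mul_nonneg (mul_nonneg hT4 hYJ) ht) ht)
  have H4 := (mul_nonneg (mul_nonneg (mul_nonneg hT4 hu) hYU) ht)
  have H5 := (mul_nonneg (mul_nonneg (mul_nonneg hT4 hYU) ht) ht)
  have H6 := (mul_nonneg (mul_nonneg (mul_nonneg hT4 ht) ht) hYM)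
  have H7 := (mul_nonneg (mul_nonneg (mul_nonneg hT5 ht) ht) hXM)
  have H8 := (mul_nonneg (mul_nonneg (mul_nonneg hBy hXJ) ht) hXMt)
  have H9 := (mul_nonneg (mul_nonneg (mul_nonneg hBy hXU) ht) hXMt)
  have H10 := (mul_nonneg (mul_nonneg (mul_nonneg hBB2 ha) ha) hXMt)
  have H11 := (mul_nonneg (mul_nonneg (mul_nonneg hBB2 ha) ht) hXMt)
  have H12 := (mul_nonneg (mul_nonneg (mul_nonneg hBB2 hδ) hδ) hXMt)
  have H13 := (mul_nonneg (mul_nonneg (mul_nonneg hBB2 hδ) ht) hXMt)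
  have H14 := (mul_nonneg (mul_nonneg (mul_nonneg hBB2 hu) hu) hXMt)
  have H15 := (mul_nonneg (mul_nonneg (mul_nonneg hBB2 hu) ht) hXMt)
  have H16 := (mul_nonneg (mul_nonneg (mul_nonneg hBB2 ht) ht) hXMt)
  have H17 := (mul_nonneg (mul_nonneg (mul_nonneg hMM ha) ha) hXMt)
  have H18 := (mul_nonneg (mul_nonneg (mul_nonneg hMM ha) ht) hXMt)
  have H19 := (mul_nonneg (mul_nonneg (mul_nonneg hMM hδ) hδ) hXMt)
  have H20 := (mul_nonneg (mul_nonneg (mul_nonneg hMM hδ) ht) hXUu)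
  have H21 := (mul_nonneg (mul_nonneg (mul_nonneg hMM hδ) ht) hXMt)
  have H22 := (mul_nonneg (mul_nonneg (mul_nonneg hMM hu) hu) hXMt)
  have H23 := (mul_nonneg (mul_nonneg (mul_nonneg hMM hu) ht) hXUu)
  have H24 := (mul_nonneg (mul_nonneg (mul_nonneg hMM hu) ht) hXMt)
  have H25 := (mul_nonneg (mul_nonneg (mul_nonneg hMM ht) ht) hXUu)
  have H26 := (mul_nonneg (mul_nonneg (mul_nonneg hMM ht) ht) hXMt)
  have H27 := (mul_nonneg (mul_nonneg (mul_nonneg hMcM2 ha) hδ) ht)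
  have H28 := (mul_nonneg (mul_nonneg (mul_nonneg hMcM2 hδ) hδ) hXMt)
  have H29 := (mul_nonneg (mul_nonneg (mul_nonneg hMcM2 hδ) ht) hXUu)
  have H30 := (mul_nonneg (mul_nonneg (mul_nonneg hMcM2 hδ) ht) hXMt)
  have H31 := (mul_nonneg (mul_nonneg hT3 hMM) ht)
  have H32 := (mul_nonneg (mul_nonneg hT4 hT2) ht)
  have H33 := (mul_nonneg (mul_nonneg hT5 hMcMx) hXM)
  have H34 := (mul_nonneg (mul_nonneg hBx hMM) ha)
  have H35 := (mul_nonneg (mul_nonneg hBx hMcM2) ha)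
  have H36 := (mul_nonneg (mul_nonneg hBx hMcM2) hu)
  have H37 := (mul_nonneg (mul_nonneg hBx hMcM2) ht)
  have H38 := (mul_nonneg (mul_nonneg hBB2 hT1) hXMt)
  have H39 := (mul_nonneg (mul_nonneg hMM hMcMx) hδ)
  have H40 := (mul_nonneg (mul_nonneg hMM hT1) hXMt)
  have H41 := (mul_nonneg (mul_nonneg hJUx hMcMy) ht)
  have H42 := (mul_nonneg (mul_nonneg hJUy hMcMx) hXMt)
  have H43 := (mul_nonneg (mul_nonneg hMcMx hMcMy) hXMt)
  have H44 := (mul_nonneg (mul_nonneg hMcMx hMcM2) hδ)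
  have H45 := (mul_nonneg (mul_nonneg hMcMy hJMx) ht)
  linear_combination H0 + H1 + H2 + 3 * H3 + H4 + 3 * H5 + H6 + 2 * H7 + H8 + H9 + H10 + H11 + H12 + H13 + H14 + H15 + H16 + 2 * H17 + H18 + 2 * H19 + H20 + 3 * H21 + H22 + H23 + H24 + H25 + H26 + H27 + H28 + H29 + H30 + H31 + H32 + H33 + H34 + H35 + H36 + H37 + 2 * H38 + H39 + 3 * H40 + H41 + H42 + H43 + H44 + H45

/-- **THE `mj` GATE ON THE PARTS MODEL**: the functional is nonnegative (`cg_mj_full_mul` for `t > 0`;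
for `t = 0` the sure-entered masses vanish and the functional is `a·L·Px·Py`). -/
theorem cg_mj_full (a δ u t XJ XU XM YJ YU YM XYM : R)
    (ha : 0 ≤ a) (hδ : 0 ≤ δ) (hu : 0 ≤ u) (ht : 0 ≤ t) (hXJ : 0 ≤ XJ) (hXU : 0 ≤ XU) (hXM : 0 ≤ XM)
    (hYJ : 0 ≤ YJ) (hYU : 0 ≤ YU) (hYM : 0 ≤ YM) (hXYM : 0 ≤ XYM)
    (hJUx : 0 ≤ XU * (a + δ) - XJ * u) (hJMx : 0 ≤ XM * (a + δ) - XJ * t)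
    (hMcMx : 0 ≤ XM * (a + δ + u) - (XJ + XU) * t) (hJUy : 0 ≤ YU * (a + δ) - YJ * u)
    (hMcMy : 0 ≤ YM * (a + δ + u) - (YJ + YU) * t) (hMcM2 : 0 ≤ XYM * (a + δ + u) - (YJ + YU) * XM)
    (hBx : 0 ≤ XM * (a + u) - XU * t) (hBy : 0 ≤ YM * (a + u) - YU * t)
    (hBB2 : 0 ≤ XYM * (a + u) - YU * XM) (hMM : 0 ≤ XYM * t - XM * YM)
    (hXUu : 0 ≤ u - XU) (hXMt : 0 ≤ t - XM) (hYMt : 0 ≤ t - YM) (hXYMx : 0 ≤ XM - XYM) :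
    0 ≤ (a + δ + u + t) * ((a + δ + u + t) * (a + δ + u + t) * XYM - (a + δ + u + t) * (YJ + YU + YM) * XM - (a + δ + u + t) * (XJ + XU + XM) * XYM + (XJ + XU + XM) * (YJ + YU + YM) * (a + XM)) - (((a + δ + u + t) * (XU + XM) - (XJ + XU + XM) * (a + u + t)) * ((a + δ + u + t) * (YJ + YU + XYM) - (YJ + YU + YM) * (a + δ + u + XM)) + ((a + δ + u + t) * (YU + YM) - (YJ + YU + YM) * (a + u + t)) * ((a + δ + u + t) * (XJ + XU + XM) - (XJ + XU + XM) * (a + δ + u + XM))) := by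
  rcases ht.lt_or_eq with htpos | ht0
  · exact (mul_nonneg_iff_of_pos_left htpos).mp (cg_mj_full_mul a δ u t XJ XU XM YJ YU YM XYM ha hδ hu ht hXJ hXU hXM
      hYJ hYU hYM hXYM hJUx hJMx hMcMx hJUy hMcMy hMcM2 hBx hBy hBB2 hMM hXUu hXMt)
  · have hXM0 : XM = 0 := le_antisymm (by linarith) hXM
    have hXYM0 : XYM = 0 := le_antisymm (by linarith) hXYM
    have hYM0 : YM = 0 := le_antisymm (by linarith) hYM
    rw [← ht0, hXM0, hXYM0, hYM0]
    have : 0 ≤ (a) * (a + δ + u + 0) * (XJ + XU + 0) * (YJ + YU + 0) :=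
      mul_nonneg (mul_nonneg (mul_nonneg ha (by linarith)) (by linarith)) (by linarith)
    linear_combination this

end MjGateAlg

end Summit.Ventures.PercRepro2.Coin
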